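import Literature.Analysis.FluidPDE.RusinSverakLeraySolutions
import Literature.Analysis.FluidPDE.NSLerayHopfSereginProofs
import Literature.Analysis.FluidPDE.LocalTypeI
import HarnessLib

/-!
# Kato solutions: smooth representative, local boundedness, and the maximal time of a datum
whose mild solution is singular at the top of its interval (Rusin–Šverák 2011, §3–§4)

Analysis/FluidPDE proofs file (no new definitions, no new named facts) over
`KatoMaximalTime.lean` (`IsKatoSolutionOn`, `katoMaximalTime` = Rusin–Šverák's `T_max(u₀)`),
complementing the Leray-side file `RusinSverakLeraySolutions.lean` (named facts **E**, **W**,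
**R** = `kato_solution_le_div_sqrt`, **S**, and the reduction of Rusin–Šverák's Cor. 4.2) in the
DAG below `Literature.Analysis.FluidPDE.rusin_sverak_minimal_data_compact`
(Rusin–Šverák, J. Funct. Anal. 260 (2011) 879–891 = arXiv:0911.0500, Cor. 4.3).

Rusin–Šverák phrase Cor. 4.2 with "`T_max(u₀^k) = T` and the singular points `z_k` of `u^k` at
`t = T`", whereas the tree's transcription `C = rusin_sverak_weak_limit_of_singular_points`
(`RusinSverakWeakStability.lean`) phrases the same hypothesis as "the Kato (mild) solution on
`[0, T)` is essentially unbounded on every backward cylinder `Q_r(T, x_k)`". This file proves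
that the two phrasings agree — **the maximal time of a datum whose Kato solution on `[0, T)`
is singular at `(T, x)` is exactly `T`** (`katoMaximalTime_eq_of_isBackwardSingularPoint`,
from the accepted smoothness fact `mild_L3_smooth`; primed version from Kato's smoothing bound
**R**) — together with the Kato-side glue this rests on:

* `ae_prod_eq_of_ae_forall_ae_eq` (product measures, `SFinite` second factor) and
  `ae_restrict_prod_of_forall_ae_eq` (time strips `(0, T) × Y`) — Fubini upgrade: two fields
  measurable on the product that agree a.e. in the second variable for (almost) every value of
  the first agree a.e. on the product (the form in which `kato_unique` — slice-wise — meets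
  space–time statements such as **W**);
* `IsKatoSolutionOn.exists_isSmoothSpaceTimeOn_ae_eq` — from `mild_L3_smooth`
  (`NSLerayHopfSereginProofs.lean`; Giga 1986, Thm. 4; Lemarié-Rieusset 2016, Thm. 15.1;
  Kato 1984; Rusin–Šverák §3 p. 5: "the mild solutions are smooth in `ℝ³ × (0, T_max(u₀))`"):
  a Kato solution on `[0, T)` agrees slice-wise a.e. with a field jointly smooth on the open
  strip, hence (`IsKatoSolutionOn.ae_eq_smooth`) a.e. on the strip;
* `IsKatoSolutionOn.eLpNorm_top_lt_top_of_isCompact` (from `mild_L3_smooth`) and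
  `IsKatoSolutionOn.eLpNorm_top_lt_top_of_isCompact'` (from **R**) — a Kato solution on `[0, T)`
  is essentially bounded on every compact subset of the open strip `(0, T) × ℝ³`;
* `katoMaximalTime_eq_of_isBackwardSingularPoint_of_bdd` — the identification itself, from any
  such local-boundedness statement for the Kato solutions of the datum: `T ≤ T_max` by
  definition of the supremum, and a Kato solution on `[0, T')`, `T' > T`, would be bounded on the
  compact closure of `Q_{√(T/2)}(T, x) ⋐ (0, T') × ℝ³` while agreeing a.e. below `T` with the
  singular one (`kato_unique`, discharged as `kato_unique_holds`;
  `eLpNorm_parabolicCylinder_eq_top_of_ae_eq`) — contradiction.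

## References

* W. Rusin, V. Šverák, *Minimal initial data for potential Navier–Stokes singularities*,
  J. Funct. Anal. 260 (2011) 879–891 = arXiv:0911.0500: §3 p. 5 (`T_max`, smoothness of mild
  solutions), §4 p. 8 (Cor. 4.2, Cor. 4.3).
* T. Kato, Math. Z. 187 (1984) 471–480, Thm. 1. Y. Giga, J. Differential Equations 62 (1986),
  Thm. 4. P. G. Lemarié-Rieusset, *The Navier–Stokes problem in the 21st century* (2016),
  Thm. 15.1.
-/

noncomputable section

open MeasureTheory TopologicalSpace Set Function Filter Topology Metric
open scoped ENNReal NNReal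

namespace Literature.Analysis.FluidPDE

/-! ## Slice-wise versus space–time a.e. equality -/

section Fubini

variable {α β F : Type*} [MeasurableSpace α] [MeasurableSpace β] {μ : Measure α} {ν : Measure β}
  [SFinite ν] [TopologicalSpace F] [MetrizableSpace F]

/-- **Fubini upgrade of slice-wise a.e. equality** (product measures): if `u, v : α → β → F`
have a.e.-strongly measurable uncurried fields for `μ.prod ν` and `u a = v a` `ν`-a.e. for
`μ`-a.e. `a`, then `uncurry u = uncurry v` `μ.prod ν`-a.e. (replace both by strongly measurable
versions, compare slices with `Measure.ae_ae_of_ae_prod`, and reassemble with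
`Measure.ae_prod_iff_ae_ae` on the measurable coincidence set). [folklore] -/
theorem ae_prod_eq_of_ae_forall_ae_eq {u v : α → β → F} (huv : ∀ᵐ a ∂μ, u a =ᵐ[ν] v a)
    (hu : AEStronglyMeasurable (uncurry u) (μ.prod ν))
    (hv : AEStronglyMeasurable (uncurry v) (μ.prod ν)) :
    uncurry u =ᵐ[μ.prod ν] uncurry v := by
  obtain ⟨U, hUm, h1⟩ : ∃ U : α × β → F, StronglyMeasurable U ∧ uncurry u =ᵐ[μ.prod ν] U :=
    ⟨_, hu.stronglyMeasurable_mk, hu.ae_eq_mk⟩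
  obtain ⟨V, hVm, h2⟩ : ∃ V : α × β → F, StronglyMeasurable V ∧ uncurry v =ᵐ[μ.prod ν] V :=
    ⟨_, hv.stronglyMeasurable_mk, hv.ae_eq_mk⟩
  have h1' : ∀ᵐ a ∂μ, ∀ᵐ b ∂ν, uncurry u (a, b) = U (a, b) := Measure.ae_ae_of_ae_prod h1
  have h2' : ∀ᵐ a ∂μ, ∀ᵐ b ∂ν, uncurry v (a, b) = V (a, b) := Measure.ae_ae_of_ae_prod h2
  have h4 : ∀ᵐ a ∂μ, ∀ᵐ b ∂ν, U (a, b) = V (a, b) := by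
    filter_upwards [h1', h2', huv] with a ha hb hc
    filter_upwards [ha, hb, hc] with b hxa hxb hxc
    rw [← hxa, ← hxb]
    exact hxc
  have hmeas : MeasurableSet {z : α × β | U z = V z} := hUm.measurableSet_eq_fun hVm
  have h5 : U =ᵐ[μ.prod ν] V := (Measure.ae_prod_iff_ae_ae hmeas).2 h4
  exact h1.trans (h5.trans h2.symm)

end Fubini

section Strip

variable {Y F : Type*} [MeasureSpace Y] [SFinite (volume : Measure Y)] [TopologicalSpace F]
  [MetrizableSpace F]

/-- **Fubini upgrade on a time strip.** If two fields on `(0, T) × Y` are measurable there and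
agree a.e. in space at every time `t ∈ (0, T)`, they agree a.e. in space–time for
`volume.restrict ((0, T) × Y)` (the form in which the slice-wise uniqueness `kato_unique` meets
space–time statements). [folklore] -/
theorem ae_restrict_prod_of_forall_ae_eq {T : ℝ} {u v : ℝ → Y → F}
    (huv : ∀ t ∈ Ioo 0 T, u t =ᵐ[volume] v t)
    (hu : AEStronglyMeasurable (uncurry u) (volume.restrict (Ioo 0 T ×ˢ univ)))
    (hv : AEStronglyMeasurable (uncurry v) (volume.restrict (Ioo 0 T ×ˢ univ))) :
    uncurry u =ᵐ[volume.restrict (Ioo 0 T ×ˢ univ)] uncurry v := by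
  have hprod : ((volume : Measure (ℝ × Y)).restrict (Ioo 0 T ×ˢ univ)) =
      ((volume : Measure ℝ).restrict (Ioo 0 T)).prod (volume : Measure Y) := by
    rw [Measure.volume_eq_prod, ← Measure.restrict_univ (μ := (volume : Measure Y)),
      Measure.prod_restrict, Measure.restrict_univ]
  rw [hprod] at hu hv ⊢
  have huv' : ∀ᵐ t ∂((volume : Measure ℝ).restrict (Ioo 0 T)), u t =ᵐ[volume] v t := by
    filter_upwards [ae_restrict_mem measurableSet_Ioo] with t ht
    exact huv t ht
  exact ae_prod_eq_of_ae_forall_ae_eq huv' hu hv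

end Strip

/-! ## The smooth representative of a Kato solution (`mild_L3_smooth`) -/

section Kato

variable {ν T : ℝ} {u₀ : EuclideanSpace ℝ (Fin 3) → EuclideanSpace ℝ (Fin 3)}
  {u : ℝ → EuclideanSpace ℝ (Fin 3) → EuclideanSpace ℝ (Fin 3)}

/-- **Smooth representative of a Kato solution** (Rusin–Šverák, J. Funct. Anal. 260 (2011)
= arXiv:0911.0500, §3 p. 5: "the mild solutions are smooth in `ℝ³ × (0, T_max(u₀))`"), from the
accepted named fact `mild_L3_smooth` (Giga 1986, Thm. 4; Lemarié-Rieusset 2016, Thm. 15.1;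
Kato 1984): a Kato solution `u` on `[0, T)` with viscosity `ν > 0` agrees at every time
`t ∈ (0, T)` a.e. with a field `w` jointly smooth on the open strip
(`IsSmoothSpaceTimeOn (Ioo 0 T) w`, the velocity of the classical solution provided by
`mild_L3_smooth`; for `T ≤ 0` the strip is empty and `w = 0` will do). The datum is in `L³` and
weakly divergence free by `IsKatoSolutionOn.memLp_initial` / `.isWeaklyDivFree_initial`.
[cite: RusinSverak2011, §3 p. 5 (arXiv:0911.0500)] -/
theorem IsKatoSolutionOn.exists_isSmoothSpaceTimeOn_ae_eq (hS : mild_L3_smooth) (hν : 0 < ν)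
    (hu : IsKatoSolutionOn T ν u₀ u) :
    ∃ w : ℝ → EuclideanSpace ℝ (Fin 3) → EuclideanSpace ℝ (Fin 3),
      IsSmoothSpaceTimeOn (Ioo 0 T) w ∧ ∀ t ∈ Ioo 0 T, u t =ᵐ[volume] w t := by
  rcases le_or_gt T 0 with hT | hT
  · refine ⟨fun _ _ => 0, ?_, fun t ht => absurd (ht.1.trans ht.2) (not_lt.2 hT)⟩
    exact contDiffOn_const
  · obtain ⟨w, π, hw, hae⟩ := hS hν hT (hu.memLp_initial hT) (hu.isWeaklyDivFree_initial hT)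
      hu.mild hu.continuousInLpOn hu.aestronglyMeasurable
    exact ⟨w, hw.smooth_velocity, fun t ht => (hae t ht).symm⟩

/-- **Space–time form**: a Kato solution on `[0, T)` agrees a.e. on the strip `(0, T) × ℝ³`
with a field jointly smooth there (`exists_isSmoothSpaceTimeOn_ae_eq` and the Fubini upgrade
`ae_restrict_prod_of_forall_ae_eq`; the smooth field is continuous, hence measurable, on the
open strip). [cite: RusinSverak2011, §3 p. 5 (arXiv:0911.0500)] -/
theorem IsKatoSolutionOn.ae_eq_smooth (hS : mild_L3_smooth) (hν : 0 < ν)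
    (hu : IsKatoSolutionOn T ν u₀ u) :
    ∃ w : ℝ → EuclideanSpace ℝ (Fin 3) → EuclideanSpace ℝ (Fin 3),
      IsSmoothSpaceTimeOn (Ioo 0 T) w ∧
        uncurry u =ᵐ[volume.restrict (Ioo 0 T ×ˢ univ)] uncurry w := by
  obtain ⟨w, hw, hae⟩ := hu.exists_isSmoothSpaceTimeOn_ae_eq hS hν
  have hstrip : IsOpen (Ioo (0 : ℝ) T ×ˢ (univ : Set (EuclideanSpace ℝ (Fin 3)))) :=
    isOpen_Ioo.prod isOpen_univ
  exact ⟨w, hw, ae_restrict_prod_of_forall_ae_eq hae hu.aestronglyMeasurable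
    (hw.continuousOn.aestronglyMeasurable hstrip.measurableSet)⟩

/-- **Local boundedness of Kato solutions, from smoothness** (`mild_L3_smooth`): a Kato
solution on `[0, T)` is essentially bounded on every compact `K ⊆ (0, T) × ℝ³` — it agrees
a.e. on the strip with its smooth version, which is continuous, hence bounded on `K`.
[cite: RusinSverak2011, §3 p. 5 (arXiv:0911.0500)] -/
theorem IsKatoSolutionOn.eLpNorm_top_lt_top_of_isCompact (hS : mild_L3_smooth) (hν : 0 < ν)
    (hu : IsKatoSolutionOn T ν u₀ u) {K : Set (ℝ × EuclideanSpace ℝ (Fin 3))}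
    (hK : IsCompact K) (hKsub : K ⊆ Ioo 0 T ×ˢ univ) :
    eLpNorm (uncurry u) ∞ (volume.restrict K) < ∞ := by
  obtain ⟨w, hw, hae⟩ := hu.ae_eq_smooth hS hν
  obtain ⟨C, hC⟩ := hK.exists_bound_of_continuousOn (hw.continuousOn.mono hKsub)
  rw [eLpNorm_congr_ae (ae_restrict_of_ae_restrict_of_subset hKsub hae), eLpNorm_exponent_top]
  exact eLpNormEssSup_lt_top_of_ae_bound
    ((ae_restrict_mem hK.measurableSet).mono fun z hz => hC z hz)

/-! ## Local boundedness from Kato's smoothing bound (**R**) -/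

/-- **Local boundedness of Kato solutions, from Kato's smoothing bound** (**R** =
`kato_solution_le_div_sqrt`, `RusinSverakLeraySolutions.lean`; Kato 1984, Thm. 1;
Lemarié-Rieusset 2016, proof of Thm. 15.1 (A)): a Kato solution on `[0, T)` is essentially
bounded on every compact `K ⊆ (0, T) × ℝ³` — the times of `K` lie in some `[a, S]`,
`0 < a ≤ S < T`, where `‖u(t, x)‖ ≤ C/√t ≤ |C|/√a` a.e. [folklore] -/
theorem IsKatoSolutionOn.eLpNorm_top_lt_top_of_isCompact' (hR : kato_solution_le_div_sqrt)
    (hν : 0 < ν) (hu : IsKatoSolutionOn T ν u₀ u) {K : Set (ℝ × EuclideanSpace ℝ (Fin 3))}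
    (hK : IsCompact K) (hKsub : K ⊆ Ioo 0 T ×ˢ univ) :
    eLpNorm (uncurry u) ∞ (volume.restrict K) < ∞ := by
  rcases K.eq_empty_or_nonempty with rfl | hne
  · simp
  -- the times of `K` lie in `[a, S] ⊆ (0, T)`
  have hfst : ContinuousOn (fun z : ℝ × EuclideanSpace ℝ (Fin 3) => z.1) K :=
    continuous_fst.continuousOn
  obtain ⟨zmin, hzminK, hzmin⟩ := hK.exists_isMinOn hne hfst
  obtain ⟨zmax, hzmaxK, hzmax⟩ := hK.exists_isMaxOn hne hfst
  have ha : 0 < zmin.1 := (hKsub hzminK).1.1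
  have hST : zmax.1 < T := (hKsub hzmaxK).1.2
  set S : ℝ := (zmax.1 + T) / 2 with hS_def
  have hS0 : 0 < S := by
    have : 0 < zmax.1 := (hKsub hzmaxK).1.1
    rw [hS_def]; linarith
  have hSlt : S < T := by rw [hS_def]; linarith
  have hzS : zmax.1 < S := by rw [hS_def]; linarith
  obtain ⟨C, hC⟩ := hR ν T u₀ u hν hu S hS0 hSlt
  have hKS : K ⊆ Ioo 0 S ×ˢ univ := fun z hz =>
    ⟨⟨(hKsub hz).1.1, lt_of_le_of_lt (show z.1 ≤ zmax.1 from hzmax hz) hzS⟩, mem_univ _⟩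
  have hC' : ∀ᵐ z ∂(volume.restrict K), ‖u z.1 z.2‖ ≤ C / Real.sqrt z.1 :=
    ae_restrict_of_ae_restrict_of_subset hKS hC
  have hbound : ∀ᵐ z ∂(volume.restrict K), ‖uncurry u z‖ ≤ |C| / Real.sqrt zmin.1 := by
    filter_upwards [hC', ae_restrict_mem hK.measurableSet] with z hz hzK
    have hsqrt_pos : 0 < Real.sqrt zmin.1 := Real.sqrt_pos.2 ha
    have hsqrt_le : Real.sqrt zmin.1 ≤ Real.sqrt z.1 := Real.sqrt_le_sqrt (hzmin hzK)
    calc ‖uncurry u z‖ = ‖u z.1 z.2‖ := rfl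
      _ ≤ C / Real.sqrt z.1 := hz
      _ ≤ |C| / Real.sqrt z.1 := by gcongr; exact le_abs_self C
      _ ≤ |C| / Real.sqrt zmin.1 := by gcongr
  rw [eLpNorm_exponent_top]
  exact eLpNormEssSup_lt_top_of_ae_bound hbound

/-! ## The maximal time of a datum whose Kato solution is singular at `(T, x)` -/

/-- **`T_max(u₀) = T` when the Kato solution on `[0, T)` is singular at `(T, x)`** — core form,
from local boundedness of the Kato solutions of `u₀` on compact subsets of their open strips
(supplied by `mild_L3_smooth` or by **R**, see the two corollaries). If `u` is a Kato solution on
`[0, T)`, `T > 0`, essentially unbounded on every backward cylinder `Q_r(T, x)`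
(`IsBackwardSingularPoint u (T, x)`), then `katoMaximalTime ν u₀ = T`: `≥` by definition of the
supremum (`IsKatoSolutionOn.ofReal_le_katoMaximalTime`); `≤` because a Kato solution `w` on
`[0, T')` with `T' > T` (`exists_isKatoSolutionOn_of_lt_katoMaximalTime`) agrees with `u` a.e.
on `(0, T) × ℝ³` (`kato_unique_holds` slice-wise, `ae_restrict_prod_of_forall_ae_eq`), hence is
singular at `(T, x)` (`eLpNorm_parabolicCylinder_eq_top_of_ae_eq`), yet is bounded on the
compact closure `[T/2, T] × B̄_{√(T/2)}(x) ⊆ (0, T') × ℝ³` of `Q_{√(T/2)}(T, x)`. This is the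
identification between "`T_max(u₀^k) = T` with a singular point at `t = T`" (Rusin–Šverák,
Cor. 4.2 as printed) and "the mild solution on `[0, T)` is singular at `(T, x_k)`"
(`rusin_sverak_weak_limit_of_singular_points`). [folklore] -/
theorem katoMaximalTime_eq_of_isBackwardSingularPoint_of_bdd (hν : 0 < ν) (hT : 0 < T)
    (hu : IsKatoSolutionOn T ν u₀ u)
    (hbdd : ∀ (T' : ℝ) (w : ℝ → EuclideanSpace ℝ (Fin 3) → EuclideanSpace ℝ (Fin 3)),
      IsKatoSolutionOn T' ν u₀ w → ∀ K : Set (ℝ × EuclideanSpace ℝ (Fin 3)), IsCompact K →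
        K ⊆ Ioo 0 T' ×ˢ univ → eLpNorm (uncurry w) ∞ (volume.restrict K) < ∞)
    {x : EuclideanSpace ℝ (Fin 3)} (hsing : IsBackwardSingularPoint u (T, x)) :
    katoMaximalTime ν u₀ = ENNReal.ofReal T := by
  refine le_antisymm (not_lt.1 fun hlt => ?_) hu.ofReal_le_katoMaximalTime
  obtain ⟨T', hTT', w, hw⟩ := exists_isKatoSolutionOn_of_lt_katoMaximalTime hlt
  have hTT : T < T' := (ENNReal.ofReal_lt_ofReal_iff'.1 hTT').1
  -- `w` agrees with `u` a.e. on `(0, T) × ℝ³`, hence is singular at `(T, x)`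
  have hae : uncurry w =ᵐ[volume.restrict (Ioo 0 T ×ˢ univ)] uncurry u :=
    ae_restrict_prod_of_forall_ae_eq
      (fun t ht => (hu.ae_eq kato_unique_holds hν hw ht.1.le ht.2 (ht.2.trans hTT)).symm)
      (hw.mono hTT.le).aestronglyMeasurable hu.aestronglyMeasurable
  -- the cylinder `Q_r(T, x)`, `r = √(T/2)`, and its compact closure inside `(0, T') × ℝ³`
  set r := Real.sqrt (T / 2) with hr_def
  have hr : 0 < r := Real.sqrt_pos.2 (by linarith)
  have hr2 : r ^ 2 = T / 2 := Real.sq_sqrt (by linarith)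
  have hsingw : eLpNorm (uncurry w) ∞ (volume.restrict (parabolicCylinder r ((T : ℝ), x))) = ∞ :=
    eLpNorm_parabolicCylinder_eq_top_of_ae_eq hT hae x (fun ρ hρ => hsing ρ hρ) hr
  set K : Set (ℝ × EuclideanSpace ℝ (Fin 3)) := Icc (T - r ^ 2) T ×ˢ closedBall x r with hK
  have hKc : IsCompact K := isCompact_Icc.prod (isCompact_closedBall _ _)
  have hKsub : K ⊆ Ioo 0 T' ×ˢ univ := by
    rintro ⟨t, y⟩ ⟨ht, -⟩
    exact ⟨⟨by linarith [ht.1], ht.2.trans_lt hTT⟩, mem_univ _⟩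
  have hQK : parabolicCylinder r ((T : ℝ), x) ⊆ K :=
    prod_mono Ioo_subset_Icc_self ball_subset_closedBall
  have hfin := hbdd T' w hw K hKc hKsub
  have hle : eLpNorm (uncurry w) ∞ (volume.restrict (parabolicCylinder r ((T : ℝ), x))) ≤
      eLpNorm (uncurry w) ∞ (volume.restrict K) :=
    eLpNorm_mono_measure (uncurry w) (Measure.restrict_mono hQK le_rfl)
  rw [hsingw] at hle
  exact (lt_of_le_of_lt hle hfin).ne rfl

/-- **`T_max(u₀) = T` when the Kato solution on `[0, T)` is singular at `(T, x)`**, from the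
smoothness of mild solutions (`mild_L3_smooth`; Rusin–Šverák §3 p. 5):
`katoMaximalTime_eq_of_isBackwardSingularPoint_of_bdd` with
`IsKatoSolutionOn.eLpNorm_top_lt_top_of_isCompact`.
[cite: RusinSverak2011, §3 p. 5 and Cor. 4.2 (arXiv:0911.0500)] -/
theorem katoMaximalTime_eq_of_isBackwardSingularPoint (hS : mild_L3_smooth) (hν : 0 < ν)
    (hT : 0 < T) (hu : IsKatoSolutionOn T ν u₀ u) {x : EuclideanSpace ℝ (Fin 3)}
    (hsing : IsBackwardSingularPoint u (T, x)) : katoMaximalTime ν u₀ = ENNReal.ofReal T :=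
  katoMaximalTime_eq_of_isBackwardSingularPoint_of_bdd hν hT hu
    (fun _ _ hw _ hK hKsub => hw.eLpNorm_top_lt_top_of_isCompact hS hν hK hKsub) hsing

/-- **`T_max(u₀) = T` when the Kato solution on `[0, T)` is singular at `(T, x)`**, from Kato's
smoothing bound (**R** = `kato_solution_le_div_sqrt`):
`katoMaximalTime_eq_of_isBackwardSingularPoint_of_bdd` with
`IsKatoSolutionOn.eLpNorm_top_lt_top_of_isCompact'`.
[cite: RusinSverak2011, §3 p. 5 and Cor. 4.2 (arXiv:0911.0500)] -/
theorem katoMaximalTime_eq_of_isBackwardSingularPoint' (hR : kato_solution_le_div_sqrt)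
    (hν : 0 < ν) (hT : 0 < T) (hu : IsKatoSolutionOn T ν u₀ u) {x : EuclideanSpace ℝ (Fin 3)}
    (hsing : IsBackwardSingularPoint u (T, x)) : katoMaximalTime ν u₀ = ENNReal.ofReal T :=
  katoMaximalTime_eq_of_isBackwardSingularPoint_of_bdd hν hT hu
    (fun _ _ hw _ hK hKsub => hw.eLpNorm_top_lt_top_of_isCompact' hR hν hK hKsub) hsing

end Kato

end Literature.Analysis.FluidPDE
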